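import Summits.QuantumFields.GaugeBoot.DiagonalRPTorusOddGaugeInvariantNegative
import HarnessLib

/-!
# The staircase pairing on the odd two-torus: lonely mirror links, swap symmetry, and the scalar of
`∫ Re χ · ρ` (gauge-boot, L3 — the last `d = 2` cell `L = 3`, `β < 0`, 1/3)

HONEST FRAMING (cell `pub-gaugeboot`, page 1 of every file): the venture produces certified bounds
on lattice expectations at stated coupling, gauge group, dimension and torus size; NOT a mass gap,
NOT a continuum limit, NOT a string tension; NOT Yang–Mills-summit-bearing (barriers
`FixedCouplingUltralocality`, `PerturbativeInvisibility`). Plumbing for the NEGATIVE structural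
result `DiagonalRPTorusThreeByThreeNegative.lean` (on `(ℤ/3)²` the gauge-invariant closed-half
diagonal RP fails for small negative `β`); no number is certified.

## Content (notation of `DiagonalRPTorusOddStaircase`: `dg`, `stairC`, `stairD`, `tailD`, `cT`, `dT`, `rr`)

* `stairD_split`, `stairD_update_dgj` — splitting / resampling the mirrored staircase at the mirror
  link `(dg k, j)` (the `stairD` twin of the tree's `stairM_update_dgj`).
* the staircase pairing `Φ₀(U) = tr ρ(stairC L U) · conj tr ρ(stairD L U)` (written out; no
  definition) — the `β`-independent part of the RP integrand of the staircase witness: continuity,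
  bound, `Φ₀(ΘU) = conj Φ₀(U)`.
* ★ `integral_stairPair_mul_eq_zero` — LONELY MIRROR LINK: for `ρ` continuous with scalar
  commutant and `ρ ≢ 1` (so `∫ ρ(s) ds = 0`), `∫ Φ₀ · R dπ = 0` for every continuous
  spectator `R` not reading the link `(dg k, j)` (`k < L`, `L ≥ 2`): the link enters only through
  `conj tr ρ(X s Y)`, whose Haar integral vanishes (the tree's one-link identity
  `integral_conj_trace_mul_weight` with the constant weight `w_0 = 1`, scalar `0`).
* `integral_stairPair_mul_comp_swap` — SWAP SYMMETRY: `∫ Φ₀ · (ψ ∘ Θ) dπ = conj ∫ Φ₀ · ψ dπ`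
  for real `ψ` (so the mirror links `(dg k, i) = θ(dg k, j)` are lonely links as well).
* ★ `wAvg_reTrace_eq_smul_pos` — `∫ Re χ_ρ(k) ρ(k) dk = κ • 1` with `κ = (∫ (Re χ_ρ)²)/N > 0`
  (scalar commutant, `N ≥ 1`): the class weight `Re χ_ρ` is inversion invariant, so the trace of
  the average is the real number `∫ (Re χ_ρ)² > 0`.

Elementary (Fubini, invariance of Haar measure). [folklore]
-/

open MeasureTheory Complex Finset Function
open scoped ComplexOrder

namespace Summit.QuantumFields.GaugeBoot

open Literature.MathematicalPhysics.QuantumFieldTheory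
open Literature.RepresentationTheory.CompactGroups

noncomputable section

namespace DiagRPTwo

/-! ## Splitting the mirrored staircase at a mirror link -/

section SplitD

variable {L : ℕ} {G : Type*} [Group G] {i j : Fin 2}

/-- Splitting the mirrored staircase at the step `k < n`:
`stairD n = stairD k · D_{dg k} · tailD k n`. -/
theorem stairD_split {k n : ℕ} (hk : k < n) (U : GaugeConfig 2 L G) :
    stairD i j n U = stairD i j k U * dT i j U (dg k) * tailD i j k n U := by
  induction n with
  | zero => exact absurd hk (Nat.not_lt_zero _)
  | succ n ih =>
    rcases Nat.lt_succ_iff_lt_or_eq.1 hk with hlt | rfl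
    · rw [stairD_succ, ih hlt, tailD_succ, if_pos hlt]; simp only [mul_assoc]
    · rw [stairD_succ, tailD_succ, if_neg (lt_irrefl k), tailD_of_le le_rfl, mul_one, mul_one]

variable [NeZero L]

/-- The first `n ≤ k` mirrored transports do not read the link `(dg k, j)` (`k < L`). -/
theorem stairD_update_dgj_of_le (hij : i ≠ j) {k n : ℕ} (hk : k < L) (hn : n ≤ k)
    (U : GaugeConfig 2 L G) (s : G) :
    stairD i j n (Function.update U (dg k, j) s) = stairD i j n U := by
  induction n with
  | zero => simp
  | succ n ih =>
    rw [stairD_succ, stairD_succ, ih (Nat.le_of_succ_le hn),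
      dT_update_dgj_of_ne hij U hk (by omega) (by omega)]

/-- ★ Resampling the link `(dg k, j)` in the closed mirrored staircase (`k < L`,
`u = U(dg k + e_j, i)`): `stairD L (U[(dg k,j) ↦ s]) = stairD k U · (s u) · tailD k L U`. -/
theorem stairD_update_dgj (hij : i ≠ j) {k : ℕ} (hk : k < L) (U : GaugeConfig 2 L G) (s : G) :
    stairD i j L (Function.update U (dg k, j) s) =
      stairD i j k U * (s * U ((dg k : Site 2 L).shift j, i)) * tailD i j k L U := by
  rw [stairD_split hk, stairD_update_dgj_of_le hij hk le_rfl, dT_update_dgj_self hij,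
    tailD_update_dgj hij hk le_rfl]

omit [NeZero L] in
/-- `stairD n (ΘU) = stairC n U`. -/
theorem stairD_configDiagSwap (n : ℕ) (U : GaugeConfig 2 L G) :
    stairD i j n (configDiagSwap i j U) = stairC i j n U := by
  rw [← stairC_configDiagSwap, configDiagSwap_configDiagSwap]

end SplitD

/-! ## The staircase pairing -/

section Pair

variable {L N : ℕ} [NeZero L] {G : Type*} [Group G] [TopologicalSpace G] [IsTopologicalGroup G]
  [CompactSpace G] (ρ : G →* Matrix (Fin N) (Fin N) ℂ) {i j : Fin 2}

omit [NeZero L] [CompactSpace G] in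
/-- The staircase pairing `Φ₀(U) = tr ρ(stairC L U) · conj tr ρ(stairD L U)` (the `β`-independent
factor of the RP integrand of the staircase witness) is continuous (the mirrored staircase is the
mixed staircase `stairM 0 L`). -/
theorem continuous_stairPair (hρ : Continuous ρ) :
    Continuous fun U : GaugeConfig 2 L G =>
      (ρ (stairC i j L U)).trace * (starRingEnd ℂ) ((ρ (stairD i j L U)).trace) := by
  have hD : Continuous fun U : GaugeConfig 2 L G => stairD i j L U := by
    simp only [← stairM_zero_left]; exact continuous_stairM 0 L
  exact (hρ.matrix_trace.comp (continuous_stairC L)).mul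
    (Complex.continuous_conj.comp (hρ.matrix_trace.comp hD))

omit [NeZero L] [IsTopologicalGroup G] in
/-- The pairing is bounded. -/
theorem exists_norm_stairPair_le (hρ : Continuous ρ) :
    ∃ C : ℝ, 0 ≤ C ∧ ∀ U : GaugeConfig 2 L G,
      ‖(ρ (stairC i j L U)).trace * (starRingEnd ℂ) ((ρ (stairD i j L U)).trace)‖ ≤ C := by
  obtain ⟨C, hC⟩ := exists_norm_trace_le ρ hρ
  have hC0 : 0 ≤ C := (norm_nonneg _).trans (hC 1)
  refine ⟨C * C, mul_nonneg hC0 hC0, fun U => ?_⟩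
  rw [norm_mul, Complex.norm_conj]
  exact mul_le_mul (hC _) (hC _) (norm_nonneg _) hC0

omit [NeZero L] [TopologicalSpace G] [IsTopologicalGroup G] [CompactSpace G] in
/-- ★ `Φ₀(ΘU) = conj Φ₀(U)`: the swap exchanges the two staircases. -/
theorem stairPair_configDiagSwap (U : GaugeConfig 2 L G) :
    (ρ (stairC i j L (configDiagSwap i j U))).trace *
        (starRingEnd ℂ) ((ρ (stairD i j L (configDiagSwap i j U))).trace) =
      (starRingEnd ℂ) ((ρ (stairC i j L U)).trace * (starRingEnd ℂ) ((ρ (stairD i j L U)).trace)) := by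
  rw [stairC_configDiagSwap, stairD_configDiagSwap, map_mul, Complex.conj_conj, mul_comm]

variable [MeasurableSpace G] [BorelSpace G] [SecondCountableTopology G]

omit [SecondCountableTopology G] in
/-- The Haar average of a NON-TRIVIAL representation with scalar commutant vanishes, in the
weighted-average form `wAvg ρ w_0 = 0 • 1` (`w_0 = 1` the Wilson weight at `β = 0`). -/
theorem wAvg_wilsonWeight_zero_eq (hρ : Continuous ρ) (hirr : TwistedSlab.HasScalarCommutant ρ)
    (hρ1 : ∃ g, ρ g ≠ 1) (hN : 1 ≤ N) :
    TwistedSlab.wAvg ρ (TwistedSlab.wilsonWeight ρ 0) =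
      (((0 : ℝ) : ℂ)) • (1 : Matrix (Fin N) (Fin N) ℂ) := by
  rw [TwistedSlab.wAvg_wilsonWeight_eq_smul_real ρ hirr hρ hN 0]
  congr 2
  simp only [TwistedSlab.wilsonWeight_zero, one_mul]
  rw [TwistedSlab.integral_re_trace_eq_zero ρ hirr hρ hρ1, zero_div]

omit [TopologicalSpace G] [IsTopologicalGroup G] [CompactSpace G] [MeasurableSpace G] [BorelSpace G]
  [SecondCountableTopology G] in
/-- `N ≥ 1` for a non-trivial representation. -/
theorem one_le_of_exists_ne_one (hρ1 : ∃ g, ρ g ≠ 1) : 1 ≤ N := by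
  rcases Nat.eq_zero_or_pos N with h0 | h0
  · exfalso
    obtain ⟨g, hg⟩ := hρ1
    subst h0
    exact hg (Subsingleton.elim _ _)
  · exact h0

omit [SecondCountableTopology G] in
/-- The one-link vanishing `∫ conj tr ρ(X (s u) Y) ds = 0` for a non-trivial `ρ` with scalar
commutant (the tree's one-link identity with the constant weight). -/
theorem integral_conj_trace_eq_zero (hρ : Continuous ρ) (hirr : TwistedSlab.HasScalarCommutant ρ)
    (hρ1 : ∃ g, ρ g ≠ 1) (X u Y : G) :
    ∫ s, (starRingEnd ℂ) ((ρ (X * (s * u) * Y)).trace) ∂(haarProbability G) = 0 := by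
  have h := integral_conj_trace_mul_weight ρ hρ (TwistedSlab.continuous_wilsonWeight ρ hρ 0)
    (wAvg_wilsonWeight_zero_eq ρ hρ hirr hρ1 (one_le_of_exists_ne_one ρ hρ1)) X u Y 1
  simpa only [TwistedSlab.wilsonWeight_zero, Complex.ofReal_one, mul_one, Complex.ofReal_zero,
    zero_mul] using h

/-- ★ **LONELY MIRROR LINK**: `ρ` continuous with scalar commutant and `ρ ≢ 1`, `k < L`, `L ≥ 2`;
for every continuous spectator `R` not reading the mirror link `(dg k, j)`,
`∫ Φ₀ · R dπ = 0` — the link enters only through `conj tr ρ(stairD L U)`, linearly, and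
`∫ ρ(s) ds = 0`. -/
theorem integral_stairPair_mul_eq_zero (h2 : 2 ≤ L) (hij : i ≠ j) (hρ : Continuous ρ)
    (hirr : TwistedSlab.HasScalarCommutant ρ) (hρ1 : ∃ g, ρ g ≠ 1) {k : ℕ} (hk : k < L)
    {R : GaugeConfig 2 L G → ℂ} (hR : Continuous R)
    (hRu : ∀ (U : GaugeConfig 2 L G) (s : G), R (Function.update U (dg k, j) s) = R U) :
    ∫ U, (ρ (stairC i j L U)).trace * (starRingEnd ℂ) ((ρ (stairD i j L U)).trace) * R U
      ∂(linkMeasure L G) = 0 := by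
  haveI : IsProbabilityMeasure (haarProbability G) := CompactGroup.isProbabilityMeasure_haarMeasure_top
  have hcont : Continuous fun U : GaugeConfig 2 L G =>
      (ρ (stairC i j L U)).trace * (starRingEnd ℂ) ((ρ (stairD i j L U)).trace) * R U :=
    (continuous_stairPair ρ hρ).mul hR
  have h := DiagRPSUN.integral_pi_update_of_forall (haarProbability G) ((dg k, j) : Edge 2 L)
    (H := fun _ => (0 : ℂ))
    (hcont.integrable_of_hasCompactSupport (HasCompactSupport.of_compactSpace _)) fun U => ?_
  · rw [h, integral_zero]
  have hupd : ∀ s : G, (ρ (stairC i j L (Function.update U (dg k, j) s))).trace *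
      (starRingEnd ℂ) ((ρ (stairD i j L (Function.update U (dg k, j) s))).trace) *
        R (Function.update U (dg k, j) s) =
      ((ρ (stairC i j L U)).trace * R U) *
        (starRingEnd ℂ) ((ρ (stairD i j k U * (s * U ((dg k : Site 2 L).shift j, i)) *
          tailD i j k L U)).trace) := by
    intro s
    rw [stairC_update_dgj h2 hij, stairD_update_dgj hij hk, hRu]
    ring
  simp_rw [hupd]
  rw [integral_const_mul, integral_conj_trace_eq_zero ρ hρ hirr hρ1, mul_zero]

omit [SecondCountableTopology G] in
/-- **SWAP SYMMETRY of the pairing**: for a real spectator `ψ`,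
`∫ Φ₀ · (ψ ∘ Θ) dπ = conj ∫ Φ₀ · ψ dπ` (`Θ` preserves `π` and conjugates `Φ₀`). -/
theorem integral_stairPair_mul_comp_swap (ψ : GaugeConfig 2 L G → ℝ) :
    ∫ U, (ρ (stairC i j L U)).trace * (starRingEnd ℂ) ((ρ (stairD i j L U)).trace) *
        (ψ (configDiagSwap i j U) : ℂ) ∂(linkMeasure L G) =
      (starRingEnd ℂ) (∫ U, (ρ (stairC i j L U)).trace * (starRingEnd ℂ) ((ρ (stairD i j L U)).trace) *
        (ψ U : ℂ) ∂(linkMeasure L G)) := by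
  have h1 : ∫ U, (ρ (stairC i j L U)).trace * (starRingEnd ℂ) ((ρ (stairD i j L U)).trace) *
        (ψ (configDiagSwap i j U) : ℂ) ∂(linkMeasure L G) =
      ∫ U, (fun V => (ρ (stairC i j L (configDiagSwap i j V))).trace *
        (starRingEnd ℂ) ((ρ (stairD i j L (configDiagSwap i j V))).trace) * (ψ V : ℂ))
          (configDiagSwap i j U) ∂(linkMeasure L G) :=
    integral_congr_ae (ae_of_all _ fun U => by simp only [configDiagSwap_configDiagSwap])
  have h2 := integral_comp_configDiagSwap (L := L) (G := G) i j
    (fun V => (ρ (stairC i j L (configDiagSwap i j V))).trace *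
        (starRingEnd ℂ) ((ρ (stairD i j L (configDiagSwap i j V))).trace) * (ψ V : ℂ))
  rw [h1, h2, ← integral_conj]
  refine integral_congr_ae (ae_of_all _ fun U => ?_)
  simp only [stairPair_configDiagSwap, map_mul, Complex.conj_ofReal]

end Pair

/-! ## The scalar of the `Re χ`-weighted average is positive -/

section Kappa

variable {N : ℕ} {G : Type*} [Group G] [TopologicalSpace G] [IsTopologicalGroup G] [CompactSpace G]
  [MeasurableSpace G] [BorelSpace G] (ρ : G →* Matrix (Fin N) (Fin N) ℂ)

omit [IsTopologicalGroup G] [CompactSpace G] [MeasurableSpace G] [BorelSpace G] in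
/-- `Re χ_ρ` is continuous. -/
theorem continuous_reChar (hρ : Continuous ρ) : Continuous fun k : G => ((ρ k).trace).re :=
  Complex.continuous_re.comp hρ.matrix_trace

omit [TopologicalSpace G] [IsTopologicalGroup G] [CompactSpace G] [MeasurableSpace G] [BorelSpace G] in
/-- `Re χ_ρ` is a class function. -/
theorem reChar_conj (g k : G) : ((ρ (g * k * g⁻¹)).trace).re = ((ρ k).trace).re := by
  rw [CompactGroup.trace_conj_eq]

/-- **The trace of the `Re χ`-weighted average is the real number `∫ (Re χ_ρ)²`.** -/
theorem trace_wAvg_reChar (hρ : Continuous ρ) :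
    (TwistedSlab.wAvg ρ fun k => ((ρ k).trace).re).trace =
      ((∫ k, ((ρ k).trace).re * ((ρ k).trace).re ∂(haarProbability G) : ℝ) : ℂ) := by
  set w : G → ℝ := fun k => ((ρ k).trace).re with hw
  have hwc : Continuous w := continuous_reChar ρ hρ
  have hwinv : ∀ k, w k⁻¹ = w k := fun k => CompactGroup.re_trace_map_inv ρ hρ k
  have hint : ∀ a b, Integrable (fun k => (w k : ℂ) * ρ k a b) (haarProbability G) :=
    fun a b => (TwistedSlab.continuous_weight_mul_entry ρ hwc hρ a b).integrable_of_hasCompactSupport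
      (HasCompactSupport.of_compactSpace _)
  have hI : Integrable (fun k => (w k : ℂ) * (ρ k).trace) (haarProbability G) :=
    ((continuous_ofReal.comp hwc).mul hρ.matrix_trace).integrable_of_hasCompactSupport
      (HasCompactSupport.of_compactSpace _)
  have h1 : (TwistedSlab.wAvg ρ w).trace = ∫ k, (w k : ℂ) * (ρ k).trace ∂(haarProbability G) := by
    simp only [Matrix.trace, Matrix.diag_apply, TwistedSlab.wAvg_apply]
    rw [← integral_finsetSum _ fun a _ => hint a a]
    exact integral_congr_ae (ae_of_all _ fun k => by simp only [Finset.mul_sum])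
  set z := ∫ k, (w k : ℂ) * (ρ k).trace ∂(haarProbability G) with hz
  have hconj : (starRingEnd ℂ) z = z := by
    rw [hz, ← integral_conj, ← integral_inv_eq_self
      (fun k : G => (w k : ℂ) * (ρ k).trace) (haarProbability G)]
    refine integral_congr_ae (ae_of_all _ fun k => ?_)
    show (starRingEnd ℂ) ((w k : ℂ) * (ρ k).trace) = (w k⁻¹ : ℂ) * (ρ k⁻¹).trace
    rw [map_mul, Complex.conj_ofReal, hwinv, CompactGroup.trace_map_inv ρ hρ]
  have hre : z.re = ∫ k, w k * w k ∂(haarProbability G) := by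
    have h := integral_re hI
    simp only [RCLike.re_to_complex] at h
    rw [hz, ← h]
    refine integral_congr_ae (ae_of_all _ fun k => ?_)
    simp only [Complex.mul_re, Complex.ofReal_re, Complex.ofReal_im, zero_mul, sub_zero, hw]
  rw [h1, ← hre]
  exact (Complex.conj_eq_iff_re.1 hconj).symm

/-- `0 < ∫ (Re χ_ρ)²` for `N ≥ 1` (continuous, non-negative, `= N²` at `k = 1`). -/
theorem integral_reChar_sq_pos (hρ : Continuous ρ) (hN : 1 ≤ N) :
    0 < ∫ k, ((ρ k).trace).re * ((ρ k).trace).re ∂(haarProbability G) := by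
  haveI : (haarProbability G).IsOpenPosMeasure := by unfold haarProbability; infer_instance
  have hc : Continuous fun k => ((ρ k).trace).re * ((ρ k).trace).re :=
    (continuous_reChar ρ hρ).mul (continuous_reChar ρ hρ)
  refine hc.integral_pos_of_hasCompactSupport_nonneg_nonzero (HasCompactSupport.of_compactSpace _)
    (fun k => mul_self_nonneg _) (x := 1) ?_
  have h1 : ((ρ 1).trace).re = N := by
    simp [Matrix.trace_one]
  rw [h1]
  have : (0 : ℝ) < N := by exact_mod_cast hN
  positivity

/-- ★ **The scalar of `∫ Re χ_ρ(k) ρ(k) dk` is real and positive**: `ρ` continuous with scalar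
commutant, `N ≥ 1` ⇒ `wAvg ρ (Re χ_ρ) = κ • 1` with `κ = (∫ (Re χ_ρ)²)/N > 0`. -/
theorem wAvg_reChar_eq_smul_pos (hirr : TwistedSlab.HasScalarCommutant ρ) (hρ : Continuous ρ)
    (hN : 1 ≤ N) :
    ∃ κ : ℝ, 0 < κ ∧ TwistedSlab.wAvg ρ (fun k => ((ρ k).trace).re) =
      ((κ : ℂ)) • (1 : Matrix (Fin N) (Fin N) ℂ) := by
  obtain ⟨c, hc⟩ := TwistedSlab.exists_wAvg_eq_smul ρ hirr (continuous_reChar ρ hρ) (reChar_conj ρ) hρ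
  have htr := trace_wAvg_reChar ρ hρ
  rw [hc, Matrix.trace_smul, Matrix.trace_one, Fintype.card_fin, smul_eq_mul] at htr
  have hNc : (N : ℂ) ≠ 0 := by exact_mod_cast (show N ≠ 0 by omega)
  have hc' : c = ((∫ k, ((ρ k).trace).re * ((ρ k).trace).re ∂(haarProbability G)) / N : ℝ) := by
    rw [Complex.ofReal_div, Complex.ofReal_natCast, ← htr, mul_div_cancel_right₀ _ hNc]
  have hNpos : (0 : ℝ) < N := by exact_mod_cast (show 0 < N by omega)
  refine ⟨_, div_pos (integral_reChar_sq_pos ρ hρ hN) hNpos, ?_⟩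
  rw [hc, hc']

end Kappa

end DiagRPTwo

end

end Summit.QuantumFields.GaugeBoot
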